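import Literature.ModelTheory.Zilber.EACDensityLineTwist
import Mathlib.Analysis.Complex.OpenMapping
import Mathlib.Analysis.SpecialFunctions.Complex.LogDeriv
import Mathlib.NumberTheory.DiophantineApproximation.Basic
import Mathlib.NumberTheory.Real.Irrational
import HarnessLib

/-!
# Real irrational slopes (2/3): the analytic core — local logarithms, open mapping, Kronecker

Zilber's Exponential-Algebraic Closedness, case ladder (host summit Schanuel, cell `pub-schanuel`,
seat 2, gen 7).  Second of three files; see `ZilberEacRealLineDensity` for the theorem.

**HONEST FRAMING.** Instances of an OPEN QUESTION (Mantova–Masser, Proc. LMS 2024, §1 p. 5);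
nothing here bears on Schanuel's conjecture (EAC ⇏ SC); `ECCell 3 2` stays OPEN.

Contents:
* `exists_int_int_near_of_irrational` — Kronecker with large `k`: for irrational `a`, every
  real target is approximated by `m + a k` with `|k|` as large as desired (Dirichlet,
  Mathlib `Real.exists_int_int_abs_mul_sub_le`).
* `eq_zero_of_forall_deriv_rel` — no nonzero polynomial satisfies `q = a·y·q'` on an infinite set
  (`a` irrational).
* `realLine_core` — THE ENGINE.  At a point `u₀ ≠ 0`, `q(u₀) ≠ 0` of the level set
  `log |u| = a log |q(u)| + Re b`, the holomorphic `L(u) = log u - a log q(u) - b` (local branches)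
  is purely imaginary and not locally constant, so by the OPEN MAPPING THEOREM
  (Mathlib `AnalyticAt.eventually_constant_or_nhds_le_map_nhds`) it attains near every point of its
  imaginary level set every value `2πi(m + a k)` with `|k|` large; each such `u` is an exponential
  point (`z = log q(u) + 2πik`, `w = u`: `e^{z} = q(w)`, `e^{a z + b} = w`).  Output: an infinite set
  of fibre values, each the limit of fibre coordinates of exponential points with `|z| → ∞`.
-/

noncomputable section

open MvPolynomial Filter Topology Complex Metric
open Literature.NumberTheory.Transcendental Literature.ModelTheory.Zilber
  Literature.ModelTheory.ExponentialFields

set_option linter.dupNamespace false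

namespace Summit.Schanuel.Schanuel.Theorems

/-! ## Part B. Kronecker-type approximation: `m + a k` near any target with `|k|` large -/

section Kronecker

/-- For irrational `a` the group `ℤ + aℤ` has arbitrarily small NONZERO elements `m + a k`
(`k ≠ 0`) — Dirichlet's approximation theorem (Mathlib `Real.exists_int_int_abs_mul_sub_le`). -/
theorem exists_int_int_abs_lt_of_irrational {a : ℝ} (ha : Irrational a) {ε : ℝ} (hε : 0 < ε) :
    ∃ k m : ℤ, k ≠ 0 ∧ 0 < |(m : ℝ) + a * k| ∧ |(m : ℝ) + a * k| < ε := by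
  obtain ⟨n, hn⟩ := exists_nat_one_div_lt hε
  obtain ⟨j, k, hk0, -, hjk⟩ := Real.exists_int_int_abs_mul_sub_le a (Nat.succ_pos n)
  refine ⟨k, -j, hk0.ne', ?_, ?_⟩
  · rw [abs_pos]
    intro h0
    apply ha.ne_rational j k
    have hk : (k : ℝ) ≠ 0 := by exact_mod_cast hk0.ne'
    rw [eq_div_iff hk]
    have h0' : -(j : ℝ) + a * k = 0 := by exact_mod_cast h0
    linarith
  · have h1 : |((-j : ℤ) : ℝ) + a * k| = |(k : ℝ) * a - j| := by
      push_cast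
      ring_nf
    rw [h1]
    refine hjk.trans_lt (lt_of_le_of_lt ?_ hn)
    rw [Nat.cast_succ]
    exact one_div_le_one_div_of_le (by positivity) (by linarith)

/-- **Kronecker with large `k`.** For irrational `a`, every real `t`, `η > 0` and `K ∈ ℕ` there are
integers `k, m` with `|k| > K` and `|m + a k - t| < η`. -/
theorem exists_int_int_near_of_irrational {a : ℝ} (ha : Irrational a) (t : ℝ) {η : ℝ}
    (hη : 0 < η) (K : ℕ) :
    ∃ k m : ℤ, (K : ℤ) < |k| ∧ |(m : ℝ) + a * k - t| < η := by
  have hK4 : (0 : ℝ) < 2 * K + 4 := by positivity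
  obtain ⟨k₁, m₁, hk₁, hgpos, hglt⟩ :=
    exists_int_int_abs_lt_of_irrational ha (div_pos hη hK4)
  set g : ℝ := (m₁ : ℝ) + a * k₁ with hg
  have hg0 : g ≠ 0 := abs_pos.mp hgpos
  set N : ℤ := ⌊t / g⌋ with hN
  have hNg : |t - N * g| ≤ |g| := by
    have h1 : (N : ℝ) ≤ t / g := Int.floor_le _
    have h2 : t / g < N + 1 := Int.lt_floor_add_one _
    have h3 : t - N * g = g * (t / g - N) := by
      field_simp
    rw [h3, abs_mul]
    calc |g| * |t / g - N| ≤ |g| * 1 := by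
          refine mul_le_mul_of_nonneg_left ?_ (abs_nonneg _)
          rw [abs_le]
          constructor <;> linarith
      _ = |g| := mul_one _
  have hgη : |g| < η := hglt.trans_le (div_le_self hη.le (by linarith))
  by_cases hK : (K : ℤ) < |N * k₁|
  · refine ⟨N * k₁, N * m₁, hK, ?_⟩
    have h1 : ((N * m₁ : ℤ) : ℝ) + a * ((N * k₁ : ℤ) : ℝ) - t = -(t - N * g) := by
      push_cast
      rw [hg]
      ring
    rw [h1, abs_neg]
    exact hNg.trans_lt hgη
  · push Not at hK
    refine ⟨(N + (2 * K + 2)) * k₁, (N + (2 * K + 2)) * m₁, ?_, ?_⟩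
    · have hk1 : (1 : ℤ) ≤ |k₁| := Int.one_le_abs hk₁
      have h2 : (N + (2 * K + 2)) * k₁ = (2 * K + 2) * k₁ - (-(N * k₁)) := by ring
      have h3 : |(2 * (K : ℤ) + 2) * k₁| = (2 * K + 2) * |k₁| := by
        rw [abs_mul, abs_of_nonneg (by positivity)]
      have h4 := abs_sub_abs_le_abs_sub ((2 * (K : ℤ) + 2) * k₁) (-(N * k₁))
      rw [abs_neg, h3] at h4
      rw [h2]
      have h5 : (2 * (K : ℤ) + 2) * 1 ≤ (2 * K + 2) * |k₁| :=
        mul_le_mul_of_nonneg_left hk1 (by positivity)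
      linarith
    · have h1 : (((N + (2 * K + 2)) * m₁ : ℤ) : ℝ) + a * (((N + (2 * K + 2)) * k₁ : ℤ) : ℝ) - t
          = -(t - N * g) + (2 * K + 2) * g := by
        push_cast
        rw [hg]
        ring
      rw [h1]
      calc |-(t - N * g) + (2 * K + 2) * g|
          ≤ |-(t - N * g)| + |(2 * K + 2) * g| := abs_add_le _ _
        _ ≤ |g| + (2 * K + 2) * |g| := by
          rw [abs_neg, abs_mul, abs_of_nonneg (by positivity : (0 : ℝ) ≤ 2 * K + 2)]
          linarith [hNg]
        _ = (2 * K + 3) * |g| := by ring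
        _ ≤ (2 * K + 3) * (η / (2 * K + 4)) :=
          mul_le_mul_of_nonneg_left hglt.le (by positivity)
        _ < η := by
          rw [← mul_div_assoc, div_lt_iff₀ hK4]
          nlinarith

end Kronecker

/-! ## Part C. The analytic core: local logarithms, open mapping, exponential points -/

section Core

/-- **No polynomial satisfies `q = a·y·q'` on an infinite set unless `q = 0`** (`a` irrational):
comparing coefficients, `q_j (1 - a j) = 0` for every `j`. -/
theorem eq_zero_of_forall_deriv_rel {a : ℝ} (ha : Irrational a) {q : Polynomial ℂ} {s : Set ℂ}
    (hs : s.Infinite)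
    (h : ∀ u ∈ s, q.eval u - (a : ℂ) * u * (Polynomial.derivative q).eval u = 0) : q = 0 := by
  set R : Polynomial ℂ := q - Polynomial.C (a : ℂ) * Polynomial.X * Polynomial.derivative q
    with hR
  have hR0 : R = 0 := by
    refine Polynomial.eq_zero_of_infinite_isRoot R (hs.mono fun u hu => ?_)
    simp only [Set.mem_setOf_eq, Polynomial.IsRoot, hR, Polynomial.eval_sub, Polynomial.eval_mul,
      Polynomial.eval_C, Polynomial.eval_X]
    exact h u hu
  ext j
  rw [Polynomial.coeff_zero]
  have hj := congrArg (fun P => Polynomial.coeff P j) hR0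
  simp only [hR, Polynomial.coeff_sub, Polynomial.coeff_zero, mul_assoc,
    Polynomial.coeff_C_mul] at hj
  cases j with
  | zero =>
    rw [Polynomial.coeff_X_mul_zero, mul_zero, sub_zero] at hj
    exact hj
  | succ j =>
    rw [Polynomial.coeff_X_mul, Polynomial.coeff_derivative] at hj
    have hne : (1 : ℂ) - (a : ℂ) * ((j : ℂ) + 1) ≠ 0 := by
      intro h0
      apply ha.ne_rational 1 ((j : ℤ) + 1)
      have h1 : (a : ℂ) * ((j : ℂ) + 1) = 1 := by linear_combination -h0
      have h2 : a * ((j : ℝ) + 1) = 1 := by exact_mod_cast h1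
      have h3 : ((j : ℝ) + 1) ≠ 0 := by positivity
      rw [eq_div_iff (by exact_mod_cast h3)]
      push_cast
      linarith
    have h4 : q.coeff (j + 1) * ((1 : ℂ) - (a : ℂ) * ((j : ℂ) + 1)) = 0 := by
      linear_combination hj
    exact (mul_eq_zero.1 h4).resolve_right hne

/-- **The analytic core.** Let `a` be irrational (real), `b ∈ ℂ`, `q ∈ ℂ[y]`, and `u₀ ≠ 0` a point
with `q(u₀) ≠ 0` on the level set `log |u₀| = a log |q(u₀)| + Re b`.  Then there is an INFINITE set
`A ⊆ ℂ` of fibre values each of which is the limit of the fibre coordinates `w_k` of exponential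
points
— `e^{z_k} = q(w_k)`, `e^{a z_k + b} = w_k` — with `|z_k| → ∞`.  (Open mapping theorem for
`L(u) = log u - a log q(u) - b` near `u₀` + Kronecker; see the module docstring.) -/
theorem realLine_core {a : ℝ} (ha : Irrational a) (b : ℂ) {q : Polynomial ℂ} {u₀ : ℂ}
    (hu₀ : u₀ ≠ 0) (hq₀ : q.eval u₀ ≠ 0)
    (hlev : Real.log ‖u₀‖ = a * Real.log ‖q.eval u₀‖ + b.re) :
    ∃ A : Set ℂ, A.Infinite ∧ ∀ α ∈ A, ∃ z w : ℕ → ℂ,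
      Tendsto (fun k => ‖z k‖) atTop atTop ∧ Tendsto w atTop (𝓝 α) ∧
      ∀ k, exp (z k) = q.eval (w k) ∧ exp ((a : ℂ) * z k + b) = w k := by
  have hq : q ≠ 0 := by
    rintro rfl
    exact hq₀ (Polynomial.eval_zero)
  -- Step 0: a ball around `u₀` on which both local logarithms are holomorphic
  obtain ⟨r, hr, hrD⟩ : ∃ r > 0, ∀ u ∈ ball u₀ r,
      u / u₀ ∈ slitPlane ∧ q.eval u / q.eval u₀ ∈ slitPlane := by
    have hc : ContinuousAt (fun u => q.eval u) u₀ := q.continuous.continuousAt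
    obtain ⟨r₂, hr₂, hr₂'⟩ := Metric.continuousAt_iff.1 hc ‖q.eval u₀‖ (norm_pos_iff.2 hq₀)
    refine ⟨min ‖u₀‖ r₂, lt_min (norm_pos_iff.2 hu₀) hr₂, fun u hu => ⟨?_, ?_⟩⟩
    · have h1 : u / u₀ = 1 + (u - u₀) / u₀ := by
        field_simp
        ring
      rw [h1]
      refine mem_slitPlane_of_norm_lt_one ?_
      rw [norm_div, div_lt_one (norm_pos_iff.2 hu₀)]
      exact (mem_ball_iff_norm.1 hu).trans_le (min_le_left _ _)
    · have h1 : q.eval u / q.eval u₀ = 1 + (q.eval u - q.eval u₀) / q.eval u₀ := by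
        field_simp
        ring
      rw [h1]
      refine mem_slitPlane_of_norm_lt_one ?_
      rw [norm_div, div_lt_one (norm_pos_iff.2 hq₀), ← dist_eq_norm]
      exact hr₂' ((mem_ball.1 hu).trans_le (min_le_right _ _))
  have hD0 : ∀ u ∈ ball u₀ r, u ≠ 0 := fun u hu h0 =>
    slitPlane_ne_zero (hrD u hu).1 (by rw [h0, zero_div])
  have hDq : ∀ u ∈ ball u₀ r, q.eval u ≠ 0 := fun u hu h0 =>
    slitPlane_ne_zero (hrD u hu).2 (by rw [h0, zero_div])
  -- the local logarithms and `L`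
  set ℓ₁ : ℂ → ℂ := fun u => log (u / u₀) + log u₀ with hℓ₁
  set ℓ₂ : ℂ → ℂ := fun u => log (q.eval u / q.eval u₀) + log (q.eval u₀) with hℓ₂
  set L : ℂ → ℂ := fun u => ℓ₁ u - (a : ℂ) * ℓ₂ u - b with hL
  have hexp₁ : ∀ u ∈ ball u₀ r, exp (ℓ₁ u) = u := by
    intro u hu
    rw [hℓ₁, exp_add, exp_log (div_ne_zero (hD0 u hu) hu₀), exp_log hu₀, div_mul_cancel₀ _ hu₀]
  have hexp₂ : ∀ u ∈ ball u₀ r, exp (ℓ₂ u) = q.eval u := by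
    intro u hu
    rw [hℓ₂, exp_add, exp_log (div_ne_zero (hDq u hu) hq₀), exp_log hq₀, div_mul_cancel₀ _ hq₀]
  -- derivatives
  have hdℓ₁ : ∀ u ∈ ball u₀ r, HasDerivAt ℓ₁ u⁻¹ u := by
    intro u hu
    have h1 : HasDerivAt (fun u : ℂ => u / u₀) (1 / u₀) u := (hasDerivAt_id u).div_const u₀
    have h2 := (h1.clog (hrD u hu).1).add_const (log u₀)
    refine h2.congr_deriv ?_
    field_simp [hD0 u hu, hu₀]
  have hdℓ₂ : ∀ u ∈ ball u₀ r,
      HasDerivAt ℓ₂ ((Polynomial.derivative q).eval u / q.eval u) u := by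
    intro u hu
    have h1 : HasDerivAt (fun u : ℂ => q.eval u / q.eval u₀)
        ((Polynomial.derivative q).eval u / q.eval u₀) u := (q.hasDerivAt u).div_const _
    have h2 := (h1.clog (hrD u hu).2).add_const (log (q.eval u₀))
    refine h2.congr_deriv ?_
    field_simp [hDq u hu, hq₀]
  have hdL : ∀ u ∈ ball u₀ r,
      HasDerivAt L (u⁻¹ - (a : ℂ) * ((Polynomial.derivative q).eval u / q.eval u)) u := by
    intro u hu
    exact ((hdℓ₁ u hu).sub ((hdℓ₂ u hu).const_mul (a : ℂ))).sub_const b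
  have hdiff : DifferentiableOn ℂ L (ball u₀ r) := fun u hu =>
    (hdL u hu).differentiableAt.differentiableWithinAt
  -- Step 1: local surjectivity of `L` near every point of the ball (open mapping theorem)
  have hsurj : ∀ u₁ ∈ ball u₀ r, ∀ ρ > (0 : ℝ), ∃ δ > (0 : ℝ), ∀ c : ℂ, ‖c - L u₁‖ < δ →
      ∃ u ∈ ball u₁ ρ, L u = c := by
    intro u₁ hu₁ ρ hρ
    have han : AnalyticAt ℂ L u₁ := hdiff.analyticAt (isOpen_ball.mem_nhds hu₁)
    rcases han.eventually_constant_or_nhds_le_map_nhds with hconst | hmap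
    · -- `L` locally constant: then `q = a y q'` near `u₁`, impossible
      exfalso
      obtain ⟨ρ', hρ', hball⟩ := Metric.mem_nhds_iff.1
        (hconst.and (isOpen_ball.mem_nhds hu₁ : ball u₀ r ∈ 𝓝 u₁))
      refine hq (eq_zero_of_forall_deriv_rel ha (infinite_of_mem_nhds u₁ (ball_mem_nhds u₁ hρ'))
        fun u hu => ?_)
      have huD : u ∈ ball u₀ r := (hball hu).2
      have hev : L =ᶠ[𝓝 u] fun _ => L u₁ :=
        Filter.eventually_of_mem (isOpen_ball.mem_nhds hu) fun v hv => (hball hv).1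
      have hd0 : deriv L u = 0 := by rw [hev.deriv_eq, deriv_const]
      rw [(hdL u huD).deriv] at hd0
      have hu0 := hD0 u huD
      have hqu := hDq u huD
      field_simp at hd0
      linear_combination hd0
    · have hmem : L '' ball u₁ ρ ∈ 𝓝 (L u₁) := hmap (image_mem_map (ball_mem_nhds u₁ hρ))
      obtain ⟨δ, hδ, hsub⟩ := Metric.mem_nhds_iff.1 hmem
      refine ⟨δ, hδ, fun c hc => ?_⟩
      obtain ⟨u, hu, huc⟩ := hsub (mem_ball_iff_norm.2 hc)
      exact ⟨u, hu, huc⟩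
  -- Step 2: `L u₀` is purely imaginary
  have hLre : (L u₀).re = 0 := by
    have h1 : L u₀ = log u₀ - (a : ℂ) * log (q.eval u₀) - b := by
      simp only [hL, hℓ₁, hℓ₂, div_self hu₀, div_self hq₀, Complex.log_one, zero_add]
    rw [h1, sub_re, sub_re, re_ofReal_mul, log_re, log_re, hlev]
    ring
  -- Step 3: the infinite set of accumulation values
  set A : Set ℂ := {u | u ∈ ball u₀ (r / 2) ∧ (L u).re = 0} with hA
  have hr2 : 0 < r / 2 := half_pos hr
  have hAD : ∀ u ∈ A, u ∈ ball u₀ r := fun u hu =>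
    mem_ball.2 ((mem_ball.1 hu.1).trans (half_lt_self hr))
  refine ⟨A, ?_, fun α hα => ?_⟩
  · -- `A` is infinite: `L` hits `t i` for all `t` near `Im L u₀`
    obtain ⟨δ, hδ, hδs⟩ := hsurj u₀ (mem_ball_self hr) (r / 2) hr2
    obtain ⟨T, hT⟩ : ∃ T : ℝ, L u₀ = (T : ℂ) * I :=
      ⟨(L u₀).im, by
        conv_lhs => rw [← re_add_im (L u₀), hLre]
        push_cast
        ring⟩
    have key : ∀ t : Set.Ioo (T - δ) (T + δ), ∃ u ∈ ball u₀ (r / 2), L u = (t : ℝ) * I := by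
      intro t
      refine hδs _ ?_
      have h1 : ((t : ℝ) : ℂ) * I - L u₀ = (((t : ℝ) - T : ℝ) : ℂ) * I := by
        rw [hT]
        push_cast
        ring
      rw [h1, norm_mul, norm_I, mul_one, norm_real, Real.norm_eq_abs, abs_lt]
      have := t.2
      constructor <;> linarith [this.1, this.2]
    choose f hf hfL using key
    haveI : Infinite (Set.Ioo (T - δ) (T + δ)) := Set.Ioo.infinite (by linarith)
    refine Set.infinite_of_injective_forall_mem (f := f) (fun t₁ t₂ h12 => ?_) fun t => ⟨hf t, ?_⟩
    · have h1 := hfL t₁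
      rw [h12, hfL t₂] at h1
      have h2 := mul_right_cancel₀ I_ne_zero h1
      exact Subtype.ext (by exact_mod_cast h2.symm)
    · rw [hfL t, mul_I_re, ofReal_im, neg_zero]
  · -- Step 4: sequences of exponential points accumulating at `α`
    have hαD : α ∈ ball u₀ r := hAD α hα
    have hLα : L α = ((L α).im : ℂ) * I := by
      conv_lhs => rw [← re_add_im (L α), hα.2]
      push_cast
      ring
    have key : ∀ j : ℕ, ∃ u : ℂ, ∃ k m : ℤ, u ∈ ball α (min (r / 2) (1 / ((j : ℝ) + 1))) ∧
        (j : ℤ) < |k| ∧ L u = ((m : ℂ) + (a : ℂ) * (k : ℂ)) * (2 * Real.pi * I) := by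
      intro j
      obtain ⟨δ, hδ, hδs⟩ := hsurj α hαD (min (r / 2) (1 / ((j : ℝ) + 1)))
        (lt_min hr2 (by positivity))
      obtain ⟨k, m, hk, hkm⟩ := exists_int_int_near_of_irrational ha ((L α).im / (2 * Real.pi))
        (div_pos hδ Real.two_pi_pos) j
      obtain ⟨u, hu, huL⟩ := hδs (((m : ℂ) + (a : ℂ) * (k : ℂ)) * (2 * Real.pi * I)) (by
        rw [hLα]
        have h1 : ((m : ℂ) + (a : ℂ) * (k : ℂ)) * (2 * Real.pi * I) - ((L α).im : ℂ) * I =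
            ((((m : ℝ) + a * k) * (2 * Real.pi) - (L α).im : ℝ) : ℂ) * I := by
          push_cast
          ring
        have h2 : ((m : ℝ) + a * k) * (2 * Real.pi) - (L α).im =
            ((m : ℝ) + a * k - (L α).im / (2 * Real.pi)) * (2 * Real.pi) := by
          rw [sub_mul, div_mul_cancel₀ _ (ne_of_gt Real.two_pi_pos)]
        rw [h1, norm_mul, norm_I, mul_one, norm_real, Real.norm_eq_abs, h2, abs_mul,
          abs_of_pos Real.two_pi_pos]
        exact (lt_div_iff₀ Real.two_pi_pos).1 hkm)
      exact ⟨u, k, m, hu, hk, huL⟩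
    choose u k m hu hk hLu using key
    have huD : ∀ j, u j ∈ ball u₀ r := by
      intro j
      have h1 : dist (u j) α < r / 2 := (mem_ball.1 (hu j)).trans_le (min_le_left _ _)
      have h2 : dist α u₀ < r / 2 := mem_ball.1 hα.1
      exact mem_ball.2 (by linarith [dist_triangle (u j) α u₀])
    refine ⟨fun j => ℓ₂ (u j) + (k j : ℂ) * (2 * Real.pi * I), u, ?_, ?_, fun j => ⟨?_, ?_⟩⟩
    · -- `|z_j| → ∞`: `|k_j| > j` while `ℓ₂ (u_j) → ℓ₂ α`
      have hw : Tendsto u atTop (𝓝 α) := by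
        rw [Metric.tendsto_atTop]
        intro ε hε
        obtain ⟨N, hN⟩ := exists_nat_one_div_lt hε
        refine ⟨N, fun j hj => ?_⟩
        have h1 : dist (u j) α < 1 / ((j : ℝ) + 1) :=
          (mem_ball.1 (hu j)).trans_le (min_le_right _ _)
        refine h1.trans_le ((one_div_le_one_div_of_le (by positivity) ?_).trans hN.le)
        exact_mod_cast Nat.succ_le_succ hj
      have hcont : ContinuousAt ℓ₂ α := (hdℓ₂ α hαD).continuousAt
      have hlim : Tendsto (fun j => ℓ₂ (u j)) atTop (𝓝 (ℓ₂ α)) := hcont.tendsto.comp hw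
      obtain ⟨B, hB⟩ := isBounded_iff_forall_norm_le.1 (isBounded_range_of_tendsto _ hlim)
      have hlow : ∀ j : ℕ, 2 * Real.pi * ((j : ℝ) + 1) - B ≤
          ‖ℓ₂ (u j) + (k j : ℂ) * (2 * Real.pi * I)‖ := by
        intro j
        have h1 : ‖(k j : ℂ) * (2 * Real.pi * I)‖ = 2 * Real.pi * |(k j : ℝ)| := by
          rw [norm_mul, norm_intCast]
          simp [abs_of_pos Real.pi_pos]
          ring
        have h2 : ((j : ℝ) + 1) ≤ |(k j : ℝ)| := by
          have := hk j
          rw [← Int.cast_abs]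
          exact_mod_cast this
        have h3 : ‖(k j : ℂ) * (2 * Real.pi * I)‖ ≤
            ‖ℓ₂ (u j) + (k j : ℂ) * (2 * Real.pi * I)‖ + ‖ℓ₂ (u j)‖ := by
          have := norm_sub_le (ℓ₂ (u j) + (k j : ℂ) * (2 * Real.pi * I)) (ℓ₂ (u j))
          rwa [add_sub_cancel_left] at this
        have h4 : ‖ℓ₂ (u j)‖ ≤ B := hB _ ⟨j, rfl⟩
        nlinarith [Real.pi_pos, h1, h2, h3, h4]
      refine tendsto_atTop_mono hlow ?_
      refine tendsto_atTop_add_const_right _ (-B) ?_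
      exact (tendsto_natCast_atTop_atTop.atTop_add tendsto_const_nhds).const_mul_atTop
        Real.two_pi_pos
    · rw [Metric.tendsto_atTop]
      intro ε hε
      obtain ⟨N, hN⟩ := exists_nat_one_div_lt hε
      refine ⟨N, fun j hj => ?_⟩
      have h1 : dist (u j) α < 1 / ((j : ℝ) + 1) :=
        (mem_ball.1 (hu j)).trans_le (min_le_right _ _)
      refine h1.trans_le ((one_div_le_one_div_of_le (by positivity) ?_).trans hN.le)
      exact_mod_cast Nat.succ_le_succ hj
    · rw [exp_add, hexp₂ _ (huD j), exp_int_mul_two_pi_mul_I, mul_one]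
    · have h1 : (a : ℂ) * (ℓ₂ (u j) + (k j : ℂ) * (2 * Real.pi * I)) + b =
          ℓ₁ (u j) + ((-m j : ℤ) : ℂ) * (2 * Real.pi * I) := by
        have h2 := hLu j
        simp only [hL] at h2
        push_cast
        linear_combination (-1 : ℂ) * h2
      rw [h1, exp_add, hexp₁ _ (huD j), exp_int_mul_two_pi_mul_I, mul_one]

end Core

end Summit.Schanuel.Schanuel.Theorems

end
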